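import Literature.NumberTheory.Automorphic.UnitaryThreeAnisotropicNormalForm      -- ★ (d1) B-p14 p841988: engine use, `exists_mul_map_eq_of_v_eq_exp_even`, `map_mul_self_eq_one_of_mulVec_eq_smul`
import Literature.NumberTheory.Automorphic.UnitaryThreeTorusBlockElements          -- ★ γ2b-A: block constructor ∕ `mem_centralizer_of_coe_eq_block` (via ★ B-p04 p841018)
import HarnessLib

/-!
# The κ = +1 normal form, step 1: an element of `U(2,1)(K)` with an eigenvector of EVEN norm valuation is `U`-conjugate into `H = Z_U(diag(1,−1,1))`
(Flicker (1998), *Elementary proof of the fundamental lemma for a unitary group*, Prop. 3 p. 78 «`T_H ⊂ H ⊂ G`», Prop. 6 p. 83; the type-(2) torus `T_H ≃ (EL)¹ × E¹` sits in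
`H = U(1,1) × U(1)`, the stabiliser of an anisotropic line of UNIT norm class)

Topic `NumberTheory/Automorphic`; namespace `Literature.NumberTheory.Automorphic.UnitaryGroup`.  THEOREMS ONLY (no `def`, no instance, no notation, no named fact,
no `sorry`).  Cell `pub/hodgecm-mathlib`, crux H413 = `stmt-HodgeConjecture-24833`, road «N7-ns COUNT FROM FLICKER» (architect A-p06 (g26)), line «N7nsCount»,
value stub `stub_irredGValuePos` (κ = +1): brick **(d3) «κ = +1 FRAME STEP»** (LEAD F0P3a-plan (g9) T8-118; B-p14 (g31) 06:50:49Z), PART 1 of 2 — the twin of ★ (d1)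
`UnitaryThreeAnisotropicNormalForm` (κ = −1: ODD norm valuation, target `Stab(w₀)`); here EVEN norm valuation, target the `e₁`-line, i.e. `H = Z(c)`, the frame of ★ A-p03
p841959 (`#Fix_{U⧸K}(t′) = phiTHM q N₊ N`) and of B-p12's γ2′ (`t′ = !![A,0,Cρ;0,b₀,0;C,0,A]`).  PART 2 (`UnitaryThreeRamifiedTorusNormalForm`) normalises the corner
inside `H`.  HONEST LABEL: HC_CM is proved only modulo the printed citations (2 remaining named inputs hLiu418, h413) until rung 0 closes; structure theory, pays
nothing by itself.

THE MATHEMATICS.  `U = U(σ, Φ₃)(K)`, `B₀(x, y) = Σ σ(xᵢ) y_{rev i}`, `e₁` the middle basis vector (`B₀(e₁,e₁) = 1`), `y₁ := e₀ + ½e₂` (`B₀(y₁,y₁) = 1`) and the FIXED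
rational unitary `h₀ = [e₀+e₁−½e₂ | y₁ | −½e₀+½e₁+¼e₂] ∈ U ∩ GL₃(𝒪)` with `h₀ e₁ = y₁` (§1).  WITT FOR THE UNIT NORM CLASS (§2–§3): if `B₀(x,x)` has EVEN valuation then
`x ∼ v` primitive with `B₀(v,v) = a`, `a⁻¹ = βσβ` a norm (★ `exists_mul_map_eq_of_v_eq_exp_even`: units of `F` are norms from the unramified `E`); if `v` has a unit
coordinate off the middle, ★ (F1′-W) `k₁(e₀ + (a∕2)e₂) = v` (`k₁ ∈ K₀`) and the torus `diag(β,1,(σβ)⁻¹)·y₁ = β(e₀ + (a∕2)e₂)`, so `(k₁ diag)·y₁ = βv` and `g := k₁·diag·h₀` has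
`g e₁ ∈ Kx`; otherwise `v ≡ ηe₁ (𝔪)` and `h₀v` has the unit coordinate `(h₀v)₀ = v₀ + v₁ − ½v₂`, so the same with `h₀ v` and `g := h₀⁻¹ k h₀`.  BLOCK FORM (§4): if `t x = u x`
then `t₁ := g⁻¹ t g` has `t₁ e₁ = u e₁`, and unitarity (`Σᵢ σ(t₁)ᵢ₁ (t₁)_{rev i, b} = δ_{b1}`) kills the middle row: **`t₁ = !![α,0,β; 0,u,0; γ,0,δ] ∈ Z_U(c)`**, `σu·u = 1`.

## References
* [Flicker1998UnitaryFL] Y. Z. Flicker, Canad. J. Math. 50 (1998), Prop. 3 p. 78, Prop. 4 pp. 80–82, Prop. 6 p. 83.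
* [Omeara1963] O. T. O'Meara, *Introduction to Quadratic Forms* (1963), §82F (integral Witt ∕ transitivity).
* [Serre1979] J.-P. Serre, *Local Fields*, GTM 67 (1979), Ch. V §2 Prop. 3 (units are norms, unramified case).
-/

set_option autoImplicit false

noncomputable section

open scoped MatrixGroups WithZero Valued
open Matrix

namespace Literature.NumberTheory.Automorphic

namespace UnitaryGroup

open Literature.NumberTheory.Automorphic.HermitianLattice

variable {K : Type*} [Field K] [Valued K ℤᵐ⁰] {ϖ : K}
  (σ : K →+* K) {J : Matrix (Fin 3) (Fin 3) K} (hJ : J = (StdForm.antidiagonal 3).over K)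

/-- `rev` on `Fin 3`. [folklore] -/ private theorem r0₃ : Fin.rev (0 : Fin 3) = 2 := rfl
/-- `rev` on `Fin 3`. [folklore] -/ private theorem r1₃ : Fin.rev (1 : Fin 3) = 1 := rfl
/-- `rev` on `Fin 3`. [folklore] -/ private theorem r2₃ : Fin.rev (2 : Fin 3) = 0 := rfl

/-! ## §1 The fixed unitary `h₀` with `h₀ e₁ = y₁ = e₀ + ½ e₂` -/

omit [Valued K ℤᵐ⁰] in
include hJ in
/-- **The rational Witt base change `h₀ ∈ U(σ, Φ₃)`** with columns `e₀ + e₁ − ½e₂`, `y₁ = e₀ + ½e₂`, `−½e₀ + ½e₁ + ¼e₂` (a hyperbolic pair orthogonal to `y₁`, and `y₁`):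
`B₀(h₀eᵢ, h₀eⱼ) = Φ₃(i,j)`; `2 ≠ 0`. [cite: Omeara1963, §82F] [cite: Flicker1998UnitaryFL, Prop. 6 p. 83] -/
theorem exists_coe_eq_wittBase (h2 : (2 : K) ≠ 0) (hσ2 : σ 2⁻¹ = 2⁻¹) :
    ∃ h₀ : ↥(unitaryGroupOfForm σ J), (((h₀ : ↥(unitaryGroupOfForm σ J)) : GL (Fin 3) K) : Matrix (Fin 3) (Fin 3) K) = !![1, 1, -(2 : K)⁻¹; 1, 0, (2 : K)⁻¹; -(2 : K)⁻¹, (2 : K)⁻¹, (2 : K)⁻¹ * (2 : K)⁻¹] := by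
  have hdet : (!![1, 1, -(2 : K)⁻¹; 1, 0, (2 : K)⁻¹; -(2 : K)⁻¹, (2 : K)⁻¹, (2 : K)⁻¹ * (2 : K)⁻¹] : Matrix (Fin 3) (Fin 3) K).det ≠ 0 := by
    have h40 : (4 : K) ≠ 0 := by rw [show (4 : K) = 2 * 2 by norm_num]; exact mul_ne_zero h2 h2
    have hd1 : (!![1, 1, -(2 : K)⁻¹; 1, 0, (2 : K)⁻¹; -(2 : K)⁻¹, (2 : K)⁻¹, (2 : K)⁻¹ * (2 : K)⁻¹] : Matrix (Fin 3) (Fin 3) K).det = -1 := by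
      rw [Matrix.det_fin_three]
      simp
      field_simp
      ring
    rw [hd1]; norm_num
  have hmem : Matrix.GeneralLinearGroup.mkOfDetNeZero _ hdet ∈ unitaryGroupOfForm σ J := by
    rw [hJ, mem_unitaryGroupOfForm_antidiagonal_iff_sum']
    intro a b
    fin_cases a <;> fin_cases b <;>
      simp [Matrix.GeneralLinearGroup.val_mkOfDetNeZero, Fin.sum_univ_three, r1₃, r2₃, map_neg, map_mul, hσ2] <;> field_simp <;> norm_num
  exact ⟨⟨_, hmem⟩, Matrix.GeneralLinearGroup.val_mkOfDetNeZero _ _⟩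

omit [Valued K ℤᵐ⁰] in
/-- `h₀ e₁ = y₁ = (1, 0, ½)`. [cite: Omeara1963, §82F] -/
theorem wittBase_mulVec_single_one :
    (!![1, 1, -(2 : K)⁻¹; 1, 0, (2 : K)⁻¹; -(2 : K)⁻¹, (2 : K)⁻¹, (2 : K)⁻¹ * (2 : K)⁻¹] : Matrix (Fin 3) (Fin 3) K) *ᵥ Pi.single 1 1 = ![1, 0, (2 : K)⁻¹] := by
  ext i
  fin_cases i <;> simp [Matrix.mulVec, dotProduct, Pi.single_apply]

omit [Valued K ℤᵐ⁰] in
/-- The torus on `y₁`: `diag(β, 1, (σβ)⁻¹)·y₁ = β·(e₀ + (a∕2)e₂)` when `β σβ a = 1`. [cite: Flicker1998UnitaryFL, Prop. 4 p. 82] -/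
theorem torusDiag_mulVec_wittVec (h2 : (2 : K) ≠ 0) {β a : K} (hβ0 : β ≠ 0) (hβ : β * σ β * a = 1) :
    (!![β, 0, 0; 0, 1, 0; 0, 0, (σ β)⁻¹] : Matrix (Fin 3) (Fin 3) K) *ᵥ ![1, 0, (2 : K)⁻¹] = β • (Pi.single 0 1 + (a / 2) • Pi.single (Fin.rev 0) 1) := by
  have hσβ0 : σ β ≠ 0 := fun h0 => by rw [h0, mul_zero, zero_mul] at hβ; exact zero_ne_one hβ
  have hσβ : (σ β)⁻¹ = β * a := (eq_inv_of_mul_eq_one_right (by linear_combination hβ : σ β * (β * a) = 1)).symm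
  rw [r0₃]
  ext i
  fin_cases i
  · simp [Matrix.mulVec, dotProduct, Fin.sum_univ_three]
  · simp [Matrix.mulVec, dotProduct, Fin.sum_univ_three]
  · simp [Matrix.mulVec, dotProduct, Fin.sum_univ_three]
    rw [hσβ]; field_simp

/-! ## §2 Witt for the unit norm class, core step: a primitive vector with a unit coordinate off the middle -/

include hJ in
/-- **Core transitivity**: for `v ∈ 𝒪³` with a unit coordinate at an index `j ≠ rev j` and `β` with `β σβ · B₀(v,v) = 1`, some `k ∈ U` has `k · y₁ = β · v`
(★ (F1′-W) `k₁(e₀ + (a∕2)e₂) = v`, then the torus `diag(β,1,(σβ)⁻¹)`). [cite: Flicker1998UnitaryFL, Prop. 4 pp. 80–82] [cite: Omeara1963, §82F] -/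
theorem exists_mulVec_wittVec_eq_smul (hd : LocalConjDatum σ ϖ) {v : Fin 3 → K} (hvL : v ∈ stdLattice K 3) {j : Fin 3} (hj : Fin.rev j ≠ j)
    (hju : Valued.v (v j) = 1) {β : K} (hβ : β * σ β * B₀ σ 3 v v = 1) :
    ∃ k : ↥(unitaryGroupOfForm σ J), (((k : ↥(unitaryGroupOfForm σ J)) : GL (Fin 3) K) : Matrix (Fin 3) (Fin 3) K) *ᵥ ![1, 0, (2 : K)⁻¹] = β • v := by
  have hσ := hd.σσ
  have hvσ := hd.vσ
  have h20 : (2 : K) ≠ 0 := fun h0 => by have := hd.v2; rw [h0, map_zero] at this; exact zero_ne_one this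
  have hβ0 : β ≠ 0 := fun h0 => by rw [h0, zero_mul, zero_mul] at hβ; exact zero_ne_one hβ
  set a : K := B₀ σ 3 v v with hadef
  have hσa : σ a = a := isHermitianForm_B₀ hσ v v
  have ha1 : Valued.v a ≤ 1 := v_B₀_le_one hvσ hvL hvL
  obtain ⟨k₁, -, hk₁v⟩ := exists_mem_unitaryInt_mulVec_normalForm_eq (N := 3) hσ hvσ hd.v2 hσa ha1 hvL hj hju rfl (i₀ := 0) (by decide)
  obtain ⟨tβ, htβ⟩ := exists_coe_eq_torusDiag σ hJ hσ hβ0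
  have hk₁J : ((k₁ : GL (Fin 3) K)) ∈ unitaryGroupOfForm σ J := by rw [hJ]; exact k₁.2
  refine ⟨⟨(k₁ : GL (Fin 3) K), hk₁J⟩ * tβ, ?_⟩
  rw [Subgroup.coe_mul, Units.val_mul, ← Matrix.mulVec_mulVec, htβ, torusDiag_mulVec_wittVec σ h20 hβ0 hβ, Matrix.mulVec_smul]
  change β • (((k₁ : GL (Fin 3) K) : Matrix (Fin 3) (Fin 3) K) *ᵥ (Pi.single 0 1 + (a / 2) • Pi.single (Fin.rev 0) 1)) = β • v
  rw [hk₁v]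

/-! ## §3 Witt for the unit norm class: `g e₁ ∈ K·x` -/

include hJ in
/-- **WITT FOR THE UNIT NORM CLASS**: if `B₀(x, x)` has EVEN valuation (`= exp 2k`) then `g·e₁ = c·x` for some `g ∈ U(σ, Φ₃)` and `c ≠ 0` — `x` spans a line `U`-conjugate to
the middle line `Ke₁`.  (`1∕B₀(v,v)` for the primitive `v ∼ x` is a `σ`-fixed element of even valuation, hence a norm `βσβ`, ★ `exists_mul_map_eq_of_v_eq_exp_even`; then
§2 directly, or after the fixed base change `h₀` when `v ≡ ηe₁ (mod 𝔪)`.) [cite: Flicker1998UnitaryFL, Prop. 3 p. 78; Prop. 4 pp. 80–82] [cite: Omeara1963, §82F]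
[cite: Serre1979, Ch. V §2 Prop. 3] -/
theorem exists_mulVec_single_one_eq_smul (hd : LocalConjDatum σ ϖ) (hσO : ∀ y : 𝒪[K], (σ.comp 𝒪[K].subtype) y ∈ 𝒪[K])
    [IsDiscreteValuationRing 𝒪[K]] [Finite (IsLocalRing.ResidueField 𝒪[K])] [IsAdicComplete 𝓂[K] 𝒪[K]]
    {a₀ : 𝒪[K]} (ha₀ : IsUnit (((σ.comp 𝒪[K].subtype).codRestrict 𝒪[K] hσO) a₀ - a₀))
    {x : Fin 3 → K} {k : ℤ} (hx : Valued.v (B₀ σ 3 x x) = WithZero.exp (2 * k)) :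
    ∃ g : ↥(unitaryGroupOfForm σ J), ∃ c : K, c ≠ 0 ∧ (((g : ↥(unitaryGroupOfForm σ J)) : GL (Fin 3) K) : Matrix (Fin 3) (Fin 3) K) *ᵥ Pi.single 1 1 = c • x := by
  have hσ := hd.σσ
  have hvσ := hd.vσ
  have h20 : (2 : K) ≠ 0 := fun h0 => by have := hd.v2; rw [h0, map_zero] at this; exact zero_ne_one this
  have hσ2 : σ (2 : K)⁻¹ = 2⁻¹ := by rw [map_inv₀, map_ofNat]
  have hv2i : Valued.v (2 : K)⁻¹ = 1 := by rw [map_inv₀, hd.v2, inv_one]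
  have hBx0 : B₀ σ 3 x x ≠ 0 := fun h0 => by rw [h0, map_zero] at hx; exact WithZero.coe_ne_zero hx.symm
  have hx0 : x ≠ 0 := by
    intro h0; apply hBx0; rw [h0]; simp
  -- the primitive vector `v = α⁻¹ x`
  obtain ⟨j, hj0, hvL, hvj⟩ := exists_inv_smul_mem_stdLattice hx0
  set α : K := x j with hαdef
  set v : Fin 3 → K := α⁻¹ • x with hvdef
  have hσα0 : σ α ≠ 0 := (map_ne_zero σ).2 hj0
  have hvα0 : Valued.v α ≠ 0 := (Valuation.ne_zero_iff _).2 hj0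
  -- `B₀(v,v)⁻¹` is a `σ`-fixed element of even valuation, hence a norm `β σβ`
  have hBv : B₀ σ 3 v v = (σ α)⁻¹ * α⁻¹ * B₀ σ 3 x x := by
    rw [hvdef]
    simp only [map_smulₛₗ, LinearMap.smul_apply, smul_eq_mul, RingHom.id_apply, map_inv₀]
    ring
  have hBv0 : B₀ σ 3 v v ≠ 0 := by rw [hBv]; exact mul_ne_zero (mul_ne_zero (inv_ne_zero hσα0) (inv_ne_zero hj0)) hBx0
  have hσBv : σ (B₀ σ 3 v v) = B₀ σ 3 v v := isHermitianForm_B₀ hσ v v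
  obtain ⟨la, hla⟩ : ∃ la : ℤ, Valued.v α = WithZero.exp la := ⟨_, (WithZero.exp_log hvα0).symm⟩
  have hvc : Valued.v (B₀ σ 3 v v)⁻¹ = WithZero.exp (2 * (la - k)) := by
    rw [map_inv₀, hBv, map_mul, map_mul, map_inv₀, map_inv₀, hvσ, hla, hx, ← WithZero.exp_neg, ← WithZero.exp_add, ← WithZero.exp_add, ← WithZero.exp_neg]
    congr 1; ring
  obtain ⟨β, hβ'⟩ := exists_mul_map_eq_of_v_eq_exp_even σ hd hσO ha₀ (by rw [map_inv₀, hσBv]) hvc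
  have hβ : β * σ β * B₀ σ 3 v v = 1 := by rw [hβ', inv_mul_cancel₀ hBv0]
  have hβ0 : β ≠ 0 := fun h0 => by rw [h0, zero_mul, zero_mul] at hβ; exact zero_ne_one hβ
  -- the fixed base change `h₀`
  obtain ⟨h₀, hh₀⟩ := exists_coe_eq_wittBase σ hJ h20 hσ2
  have hh₀e : (((h₀ : ↥(unitaryGroupOfForm σ J)) : GL (Fin 3) K) : Matrix (Fin 3) (Fin 3) K) *ᵥ Pi.single 1 1 = ![1, 0, (2 : K)⁻¹] := by rw [hh₀]; exact wittBase_mulVec_single_one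
  have hmat : ∀ a c : ↥(unitaryGroupOfForm σ J), (((a * c : ↥(unitaryGroupOfForm σ J)) : GL (Fin 3) K) : Matrix (Fin 3) (Fin 3) K) = (((a : ↥(unitaryGroupOfForm σ J)) : GL (Fin 3) K) : Matrix (Fin 3) (Fin 3) K) * (((c : ↥(unitaryGroupOfForm σ J)) : GL (Fin 3) K) : Matrix (Fin 3) (Fin 3) K) := fun a c => by rw [Subgroup.coe_mul, Units.val_mul]
  by_cases hgood : ∃ j', Fin.rev j' ≠ j' ∧ Valued.v (v j') = 1
  · -- a unit coordinate off the middle: §2 directly, `g := k h₀`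
    obtain ⟨j', hj', hj'u⟩ := hgood
    obtain ⟨kk, hkk⟩ := exists_mulVec_wittVec_eq_smul σ hJ hd hvL hj' hj'u hβ
    refine ⟨kk * h₀, β * α⁻¹, mul_ne_zero hβ0 (inv_ne_zero hj0), ?_⟩
    rw [hmat, ← Matrix.mulVec_mulVec, hh₀e, hkk, hvdef, smul_smul]
  · -- `v ≡ η e₁ (mod 𝔪)`: go through `h₀ v`, whose `0`-th coordinate `v₀ + v₁ − ½v₂` is a unit
    push Not at hgood
    have hv0 : Valued.v (v 0) < 1 := lt_of_le_of_ne (hvL 0) (hgood 0 (by decide))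
    have hv2 : Valued.v (v 2) < 1 := lt_of_le_of_ne (hvL 2) (hgood 2 (by decide))
    have hv1 : Valued.v (v 1) = 1 := by
      have hvj1 : Valued.v (v j) = 1 := by rw [hvj, map_one]
      fin_cases j
      · exact absurd hvj1 (hgood 0 (by decide))
      · exact hvj1
      · exact absurd hvj1 (hgood 2 (by decide))
    set v₃ : Fin 3 → K := (((h₀ : ↥(unitaryGroupOfForm σ J)) : GL (Fin 3) K) : Matrix (Fin 3) (Fin 3) K) *ᵥ v with hv₃def
    have hh₀int : ∀ i l, Valued.v ((((h₀ : ↥(unitaryGroupOfForm σ J)) : GL (Fin 3) K) : Matrix (Fin 3) (Fin 3) K) i l) ≤ 1 := by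
      intro i l
      rw [hh₀]
      fin_cases i <;> fin_cases l <;> simp [hv2i]
    have hv₃L : v₃ ∈ stdLattice K 3 := fun i => v_mulVec_apply_le_of_forall_le hh₀int hvL i
    have hv₃0 : Valued.v (v₃ 0) = 1 := by
      have e0 : v₃ 0 = v 1 + (v 0 + -(2 : K)⁻¹ * v 2) := by
        rw [hv₃def, hh₀]; simp [Matrix.mulVec, dotProduct, Fin.sum_univ_three]; ring
      have hsmall : Valued.v (v 0 + -(2 : K)⁻¹ * v 2) < 1 := by
        refine lt_of_le_of_lt (Valuation.map_add _ _ _) (max_lt hv0 ?_)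
        rw [map_mul, Valuation.map_neg, hv2i, one_mul]; exact hv2
      rw [e0, Valuation.map_add_eq_of_lt_left _ (by rw [hv1]; exact hsmall), hv1]
    have hβ₃ : β * σ β * B₀ σ 3 v₃ v₃ = 1 := by rw [hv₃def, B₀_mulVec_mulVec_of_mem σ hJ h₀ v v]; exact hβ
    obtain ⟨kk, hkk⟩ := exists_mulVec_wittVec_eq_smul σ hJ hd hv₃L (j := 0) (by decide) hv₃0 hβ₃
    refine ⟨h₀⁻¹ * kk * h₀, β * α⁻¹, mul_ne_zero hβ0 (inv_ne_zero hj0), ?_⟩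
    have h1 : (((h₀⁻¹ * h₀ : ↥(unitaryGroupOfForm σ J)) : GL (Fin 3) K) : Matrix (Fin 3) (Fin 3) K) = 1 := by rw [inv_mul_cancel, Subgroup.coe_one, Units.val_one]
    have hback : (((h₀⁻¹ : ↥(unitaryGroupOfForm σ J)) : GL (Fin 3) K) : Matrix (Fin 3) (Fin 3) K) *ᵥ v₃ = v := by
      have := congrArg (fun A : Matrix (Fin 3) (Fin 3) K => A *ᵥ v) h1
      simpa only [hmat, ← Matrix.mulVec_mulVec, Matrix.one_mulVec] using this
    rw [hmat, hmat, ← Matrix.mulVec_mulVec, ← Matrix.mulVec_mulVec, hh₀e, hkk, Matrix.mulVec_smul, hback, hvdef, smul_smul]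

/-! ## §4 The block form in `H = Z_U(c)` -/

include hJ in
/-- **THE κ = +1 FRAME STEP, part 1 — INTO `H`**: if `t ∈ U` has an eigenvector `x` (`t x = u x`) whose norm `B₀(x,x)` has EVEN valuation, then for some `g ∈ U` the conjugate
`g⁻¹ t g` fixes the middle line: **`g⁻¹ t g = !![α, 0, β; 0, u, 0; γ, 0, δ]`** (so `g⁻¹ t g ∈ Z_U(diag(1,−1,1)) = H`, ★ `mem_centralizer_of_coe_eq_block`), and `σu·u = 1`.
[cite: Flicker1998UnitaryFL, Prop. 3 p. 78; Prop. 6 p. 83] -/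
theorem exists_conj_coe_eq_block_of_eigen (hd : LocalConjDatum σ ϖ) (hσO : ∀ y : 𝒪[K], (σ.comp 𝒪[K].subtype) y ∈ 𝒪[K])
    [IsDiscreteValuationRing 𝒪[K]] [Finite (IsLocalRing.ResidueField 𝒪[K])] [IsAdicComplete 𝓂[K] 𝒪[K]]
    {a₀ : 𝒪[K]} (ha₀ : IsUnit (((σ.comp 𝒪[K].subtype).codRestrict 𝒪[K] hσO) a₀ - a₀))
    {t : ↥(unitaryGroupOfForm σ J)} {x : Fin 3 → K} {u : K} (htx : (((t : ↥(unitaryGroupOfForm σ J)) : GL (Fin 3) K) : Matrix (Fin 3) (Fin 3) K) *ᵥ x = u • x) {k : ℤ} (hx : Valued.v (B₀ σ 3 x x) = WithZero.exp (2 * k)) :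
    ∃ g : ↥(unitaryGroupOfForm σ J), ∃ α β γ δ : K, (((g⁻¹ * t * g : ↥(unitaryGroupOfForm σ J)) : GL (Fin 3) K) : Matrix (Fin 3) (Fin 3) K) = !![α, 0, β; 0, u, 0; γ, 0, δ] ∧ σ u * u = 1 := by
  have hBx0 : B₀ σ 3 x x ≠ 0 := fun h0 => by rw [h0, map_zero] at hx; exact WithZero.coe_ne_zero hx.symm
  have hu : σ u * u = 1 := map_mul_self_eq_one_of_mulVec_eq_smul σ hJ t htx hBx0
  have hu0 : u ≠ 0 := fun h0 => by rw [h0, mul_zero] at hu; exact zero_ne_one hu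
  have hσu0 : σ u ≠ 0 := (map_ne_zero σ).2 hu0
  obtain ⟨g, c, hc0, hg⟩ := exists_mulVec_single_one_eq_smul σ hJ hd hσO ha₀ hx
  have hmat : ∀ a b : ↥(unitaryGroupOfForm σ J), (((a * b : ↥(unitaryGroupOfForm σ J)) : GL (Fin 3) K) : Matrix (Fin 3) (Fin 3) K) = (((a : ↥(unitaryGroupOfForm σ J)) : GL (Fin 3) K) : Matrix (Fin 3) (Fin 3) K) * (((b : ↥(unitaryGroupOfForm σ J)) : GL (Fin 3) K) : Matrix (Fin 3) (Fin 3) K) := fun a b => by rw [Subgroup.coe_mul, Units.val_mul]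
  set t₁ : ↥(unitaryGroupOfForm σ J) := g⁻¹ * t * g with ht₁
  -- the middle column: `t₁ e₁ = u e₁`
  have h1 : (((g⁻¹ * g : ↥(unitaryGroupOfForm σ J)) : GL (Fin 3) K) : Matrix (Fin 3) (Fin 3) K) = 1 := by rw [inv_mul_cancel, Subgroup.coe_one, Units.val_one]
  have hback : (((g⁻¹ : ↥(unitaryGroupOfForm σ J)) : GL (Fin 3) K) : Matrix (Fin 3) (Fin 3) K) *ᵥ (c • x) = Pi.single 1 1 := by
    have := congrArg (fun A : Matrix (Fin 3) (Fin 3) K => A *ᵥ (Pi.single 1 1 : Fin 3 → K)) h1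
    simpa only [hmat, ← Matrix.mulVec_mulVec, hg, Matrix.one_mulVec] using this
  have hcol : (((t₁ : ↥(unitaryGroupOfForm σ J)) : GL (Fin 3) K) : Matrix (Fin 3) (Fin 3) K) *ᵥ Pi.single 1 1 = u • Pi.single 1 1 := by
    rw [ht₁, hmat, hmat, ← Matrix.mulVec_mulVec, ← Matrix.mulVec_mulVec, hg, Matrix.mulVec_smul, htx, smul_comm c u x, Matrix.mulVec_smul, hback]
  have hcol' : ∀ i, (((t₁ : ↥(unitaryGroupOfForm σ J)) : GL (Fin 3) K) : Matrix (Fin 3) (Fin 3) K) i 1 = (u • (Pi.single 1 1 : Fin 3 → K)) i := by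
    intro i
    have := congrFun hcol i
    rw [Matrix.mulVec_single_one] at this
    exact this
  have e01 : (((t₁ : ↥(unitaryGroupOfForm σ J)) : GL (Fin 3) K) : Matrix (Fin 3) (Fin 3) K) 0 1 = 0 := by rw [hcol' 0]; simp
  have e11 : (((t₁ : ↥(unitaryGroupOfForm σ J)) : GL (Fin 3) K) : Matrix (Fin 3) (Fin 3) K) 1 1 = u := by rw [hcol' 1]; simp
  have e21 : (((t₁ : ↥(unitaryGroupOfForm σ J)) : GL (Fin 3) K) : Matrix (Fin 3) (Fin 3) K) 2 1 = 0 := by rw [hcol' 2]; simp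
  -- the middle row from unitarity
  have ht₁3 : ((t₁ : GL (Fin 3) K)) ∈ unitaryGroupOfForm σ ((StdForm.antidiagonal 3).over K) := by rw [← hJ]; exact t₁.2
  have hrow : ∀ b : Fin 3, ∑ i, σ ((((t₁ : ↥(unitaryGroupOfForm σ J)) : GL (Fin 3) K) : Matrix (Fin 3) (Fin 3) K) i 1) *
      (((t₁ : ↥(unitaryGroupOfForm σ J)) : GL (Fin 3) K) : Matrix (Fin 3) (Fin 3) K) (Fin.rev i) b = if b = Fin.rev 1 then 1 else 0 := by
    have h := ht₁3
    rw [mem_unitaryGroupOfForm_antidiagonal_iff_sum'] at h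
    exact h 1
  have e10 : (((t₁ : ↥(unitaryGroupOfForm σ J)) : GL (Fin 3) K) : Matrix (Fin 3) (Fin 3) K) 1 0 = 0 := by
    have h := hrow 0
    rw [Fin.sum_univ_three, r0₃, r1₃, r2₃, e01, e11, e21, map_zero, zero_mul, zero_mul, zero_add, add_zero, if_neg (by decide)] at h
    exact (mul_eq_zero.1 h).resolve_left hσu0
  have e12 : (((t₁ : ↥(unitaryGroupOfForm σ J)) : GL (Fin 3) K) : Matrix (Fin 3) (Fin 3) K) 1 2 = 0 := by
    have h := hrow 2
    rw [Fin.sum_univ_three, r0₃, r1₃, r2₃, e01, e11, e21, map_zero, zero_mul, zero_mul, zero_add, add_zero, if_neg (by decide)] at h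
    exact (mul_eq_zero.1 h).resolve_left hσu0
  refine ⟨g, (((t₁ : ↥(unitaryGroupOfForm σ J)) : GL (Fin 3) K) : Matrix (Fin 3) (Fin 3) K) 0 0, (((t₁ : ↥(unitaryGroupOfForm σ J)) : GL (Fin 3) K) : Matrix (Fin 3) (Fin 3) K) 0 2, (((t₁ : ↥(unitaryGroupOfForm σ J)) : GL (Fin 3) K) : Matrix (Fin 3) (Fin 3) K) 2 0, (((t₁ : ↥(unitaryGroupOfForm σ J)) : GL (Fin 3) K) : Matrix (Fin 3) (Fin 3) K) 2 2, ?_, hu⟩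
  rw [← ht₁]
  ext i l
  fin_cases i <;> fin_cases l <;> simp [e01, e11, e21, e10, e12]

end UnitaryGroup

end Literature.NumberTheory.Automorphic

end
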